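import Literature.Probability.RandomPlanarGeometry.RestrictionCovariance
import Literature.Probability.RandomPlanarGeometry.HalfPlaneFillProofs
import HarnessLib

/-!
# Measurable events of the configuration space `Ω`: points, discs, interior; simple curves

Elementary measure-theoretic facts about the space `Ω` of [LSW] Def. 3.1
(`Literature.Probability.RandomPlanarGeometry.RestrictionConfig`, with the σ-field generated by the avoidance events `{K ∩ A = ∅}`,
`A ∈ 𝒬*`, `RestrictionMeasures`), after

* G. F. Lawler, O. Schramm, W. Werner, *Conformal restriction: the chordal case*, J. Amer. Math.
  Soc. **16** (2003) 917–955, arXiv:math/0209343 (**[LSW]**), §3 p. 10: "We endow `Ω` with the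
  σ-field generated by the events `{K ∈ Ω : K ∩ A = ∅}`, where `A ∈ 𝒬*`. … It is worthwhile
  to note that the σ-field on `Ω` is the same as the Borel σ-field induced by the Hausdorff
  metric on closed subsets of `ℍ̄ ∪ {∞}`."

We PROVE the part of this remark that the bubble description of the restriction measures
`P_α`, `α > 5/8` ([LSW] Thm. 7.3) needs in order to contradict "supported on simple curves"
(p. 5 result 2; the named facts `IsRestrictionMeasure.eq_five_eighths_of_outer_simple` and its
`α > 5/8` ingredient): the avoidance σ-field sees points and interiors, and simple curves have
no interior.

* `Literature.Probability.RandomPlanarGeometry.dyadicSquare`, `Literature.Probability.RandomPlanarGeometry.dyadicUnion` — closed dyadic squares of generation `n` and finite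
  unions of them (a countable family of compact test sets);
* `Literature.Probability.RandomPlanarGeometry.RestrictionConfig.exists_dyadicUnion_isStarHull_hpFill` — for `K ∈ Ω` and a closed disc
  `B̄(z, ε)` off `cl K`, some finite union `S` of dyadic squares contains the disc, and its
  half-plane fill `hpFill S` ([LSW] §2 "Fillings", `HalfPlaneFill`) is a `*`-hull avoided by
  `K`: join `z` to `−i` inside the open connected set `ℂ ∖ cl K` (Def. 3.1 (2)) and take the
  squares of a fine generation meeting the disc or the path; `0 ∉ hpFill S` because
  `K ∪ (B(0, ρ) ∩ ℍ)` is connected, unbounded and misses `S`. Simple connectivity of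
  `ℍ ∖ hpFill S` is Conway VIII.2.2, the named fact `isSimplyConnected_of_isConnected_compl` of
  `HalfPlaneFill`, PROVED in the tree (`isSimplyConnected_of_isConnected_compl_holds`,
  `HalfPlaneFillProofs`), so all statements below are unconditional;
* `Literature.Probability.RandomPlanarGeometry.RestrictionConfig.measurableSet_mem` — `{K : z ∈ K}` is measurable for every `z ∈ ℂ`
  (`= ⋂ₘ (missNear z (1/(m+1)))ᶜ` for `z ∈ ℍ`, the `missNear` being countable unions of
  generating events); hence `measurableSet_ball_subset` (`{K : B(q, r) ⊆ K}`, through a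
  countable dense set, `K` being relatively closed), `measurableSet_interior_nonempty` and
  `measurableSet_interior_eq_empty`;
* `Literature.Probability.RandomPlanarGeometry.RestrictionConfig.IsSimplePath.interior_eq_empty` — a simple curve `γ(0, ∞)` (`γ`
  continuous, injective, `|γ(t)| → ∞`) has empty interior: `γ` is a closed embedding, and a
  circle inside a disc of `γ(0, ∞)` would pull back to a continuous injective map of the circle
  into `[0, ∞)`, contradicting the intermediate value theorem;
* `Literature.Probability.RandomPlanarGeometry.RestrictionConfig.exists_measurableSet_simple_subset_of_ae_interior_nonempty` — the
  glue: if `P`-almost every configuration has an interior point, the measurable event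
  `{int K = ∅} ⊇ {simple curves}` is `P`-null, so the simple curves do not have full outer
  `P`-measure (the form of the hypothesis of `IsRestrictionMeasure.eq_five_eighths_of_outer_simple`).

Mathlib: `isProperMap_iff_tendsto_cocompact`, `IsClosedEmbedding.of_continuous_injective_isClosedMap`,
`IsInducing.continuous_iff`, `intermediate_value_univ`, `IsOpen.isConnected_iff_isPathConnected`,
`JoinedIn.somePath`, `IsCompact.exists_cthickening_subset_open`, `isPreconnected_of_forall`,
`TopologicalSpace.exists_countable_dense`, `Dense.open_subset_closure_inter`.
-/

noncomputable section

open Set Filter Topology MeasureTheory Metric Bornology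
open UpperHalfPlane (upperHalfPlaneSet)
open scoped NNReal ENNReal

namespace Literature.Probability.RandomPlanarGeometry

/-! ### Closed dyadic squares -/

/-- The closed dyadic square of generation `n` with lower-left corner `(a/2ⁿ, b/2ⁿ)`. [folklore] -/
def dyadicSquare (n : ℕ) (a b : ℤ) : Set ℂ :=
  {z : ℂ | (a : ℝ) / 2 ^ n ≤ z.re ∧ z.re ≤ ((a : ℝ) + 1) / 2 ^ n ∧
    (b : ℝ) / 2 ^ n ≤ z.im ∧ z.im ≤ ((b : ℝ) + 1) / 2 ^ n}

/-- The union of the dyadic squares of generation `n` indexed by a finite set. [folklore] -/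
def dyadicUnion (n : ℕ) (F : Finset (ℤ × ℤ)) : Set ℂ := ⋃ p ∈ F, dyadicSquare n p.1 p.2

section Dyadic

variable {n : ℕ} {a b : ℤ}

/-- A dyadic square as a product of two closed intervals. [folklore] -/
theorem dyadicSquare_eq : dyadicSquare n a b =
    Complex.re ⁻¹' Icc ((a : ℝ) / 2 ^ n) (((a : ℝ) + 1) / 2 ^ n) ∩
      Complex.im ⁻¹' Icc ((b : ℝ) / 2 ^ n) (((b : ℝ) + 1) / 2 ^ n) := by
  ext z
  simp only [dyadicSquare, mem_setOf_eq, mem_inter_iff, mem_preimage, mem_Icc]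
  tauto

/-- Dyadic squares are closed. [folklore] -/
theorem isClosed_dyadicSquare : IsClosed (dyadicSquare n a b) := by
  rw [dyadicSquare_eq]
  exact (isClosed_Icc.preimage Complex.continuous_re).inter
    (isClosed_Icc.preimage Complex.continuous_im)

/-- Dyadic squares are convex. [folklore] -/
theorem convex_dyadicSquare : Convex ℝ (dyadicSquare n a b) := by
  rw [dyadicSquare_eq]
  exact ((convex_Icc _ _).linear_preimage Complex.reLm).inter
    ((convex_Icc _ _).linear_preimage Complex.imLm)

/-- Every point lies in the dyadic square of its floor coordinates. [folklore] -/
theorem mem_dyadicSquare_floor (z : ℂ) (n : ℕ) :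
    z ∈ dyadicSquare n ⌊(2 : ℝ) ^ n * z.re⌋ ⌊(2 : ℝ) ^ n * z.im⌋ := by
  have h2 : (0 : ℝ) < 2 ^ n := by positivity
  refine ⟨?_, ?_, ?_, ?_⟩
  · rw [div_le_iff₀ h2, mul_comm]
    exact Int.floor_le _
  · rw [le_div_iff₀ h2, mul_comm]
    exact (Int.lt_floor_add_one _).le
  · rw [div_le_iff₀ h2, mul_comm]
    exact Int.floor_le _
  · rw [le_div_iff₀ h2, mul_comm]
    exact (Int.lt_floor_add_one _).le

/-- Two points of a dyadic square of generation `n` are within distance `2/2ⁿ`. [folklore] -/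
theorem dist_le_of_mem_dyadicSquare {z w : ℂ} (hz : z ∈ dyadicSquare n a b)
    (hw : w ∈ dyadicSquare n a b) : dist z w ≤ 2 / 2 ^ n := by
  obtain ⟨hz1, hz2, hz3, hz4⟩ := hz
  obtain ⟨hw1, hw2, hw3, hw4⟩ := hw
  have h2 : (0 : ℝ) < 2 ^ n := by positivity
  rw [dist_eq_norm]
  refine (Complex.norm_le_abs_re_add_abs_im _).trans ?_
  rw [Complex.sub_re, Complex.sub_im]
  have hre : |z.re - w.re| ≤ 1 / 2 ^ n := by
    rw [abs_le]
    constructor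
    · have : ((a : ℝ) + 1) / 2 ^ n - (a : ℝ) / 2 ^ n = 1 / 2 ^ n := by ring
      linarith
    · have : ((a : ℝ) + 1) / 2 ^ n - (a : ℝ) / 2 ^ n = 1 / 2 ^ n := by ring
      linarith
  have him : |z.im - w.im| ≤ 1 / 2 ^ n := by
    rw [abs_le]
    constructor
    · have : ((b : ℝ) + 1) / 2 ^ n - (b : ℝ) / 2 ^ n = 1 / 2 ^ n := by ring
      linarith
    · have : ((b : ℝ) + 1) / 2 ^ n - (b : ℝ) / 2 ^ n = 1 / 2 ^ n := by ring
      linarith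
  have : (1 : ℝ) / 2 ^ n + 1 / 2 ^ n = 2 / 2 ^ n := by ring
  linarith

/-- The indices of a dyadic square of generation `n` through `z` are at most `2ⁿ ‖z‖ + 1` in
absolute value. [folklore] -/
theorem abs_le_of_mem_dyadicSquare {z : ℂ} (hz : z ∈ dyadicSquare n a b) :
    |(a : ℝ)| ≤ 2 ^ n * ‖z‖ + 1 ∧ |(b : ℝ)| ≤ 2 ^ n * ‖z‖ + 1 := by
  obtain ⟨hz1, hz2, hz3, hz4⟩ := hz
  have h2 : (0 : ℝ) < 2 ^ n := by positivity
  have hre := Complex.abs_re_le_norm z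
  have him := Complex.abs_im_le_norm z
  rw [div_le_iff₀ h2] at hz1 hz3
  rw [le_div_iff₀ h2] at hz2 hz4
  rw [abs_le] at hre him
  constructor
  · rw [abs_le]
    constructor <;> nlinarith [hre.1, hre.2]
  · rw [abs_le]
    constructor <;> nlinarith [him.1, him.2]

/-- Only finitely many dyadic squares of a given generation meet a bounded set. [folklore] -/
theorem finite_setOf_dyadicSquare_inter_nonempty {C : Set ℂ} (hC : Bornology.IsBounded C) (n : ℕ) :
    {p : ℤ × ℤ | (dyadicSquare n p.1 p.2 ∩ C).Nonempty}.Finite := by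
  obtain ⟨R, hR⟩ := hC.subset_closedBall 0
  set N : ℤ := ⌈(2 : ℝ) ^ n * R + 1⌉ with hN
  refine ((Set.finite_Icc (-N) N).prod (Set.finite_Icc (-N) N)).subset ?_
  rintro ⟨a, b⟩ ⟨z, hz, hzC⟩
  have hzR : ‖z‖ ≤ R := by simpa [mem_closedBall, dist_zero_right] using hR hzC
  obtain ⟨ha, hb⟩ := abs_le_of_mem_dyadicSquare hz
  have h2 : (0 : ℝ) < 2 ^ n := by positivity
  have ha' : |(a : ℝ)| ≤ N := by
    refine le_trans ?_ (Int.le_ceil _)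
    nlinarith
  have hb' : |(b : ℝ)| ≤ N := by
    refine le_trans ?_ (Int.le_ceil _)
    nlinarith
  rw [abs_le] at ha' hb'
  have h1 : -N ≤ a := by exact_mod_cast ha'.1
  have h2 : a ≤ N := by exact_mod_cast ha'.2
  have h3 : -N ≤ b := by exact_mod_cast hb'.1
  have h4 : b ≤ N := by exact_mod_cast hb'.2
  exact ⟨⟨h1, h2⟩, ⟨h3, h4⟩⟩

end Dyadic

/-! ### Finite unions of dyadic squares -/

section Union

variable {n : ℕ} {F : Finset (ℤ × ℤ)}

/-- Membership in a dyadic union. [folklore] -/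
theorem mem_dyadicUnion_iff {z : ℂ} : z ∈ dyadicUnion n F ↔ ∃ p ∈ F, z ∈ dyadicSquare n p.1 p.2 := by
  simp [dyadicUnion]

/-- Dyadic unions are closed. [folklore] -/
theorem isClosed_dyadicUnion : IsClosed (dyadicUnion n F) :=
  F.finite_toSet.isClosed_biUnion fun _ _ ↦ isClosed_dyadicSquare

/-- Dyadic squares are bounded. [folklore] -/
theorem isBounded_dyadicSquare {a b : ℤ} : IsBounded (dyadicSquare n a b) := by
  rcases (dyadicSquare n a b).eq_empty_or_nonempty with h | ⟨z, hz⟩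
  · rw [h]
    exact isBounded_empty
  · refine (isBounded_iff_subset_closedBall z).2 ⟨2 / 2 ^ n, fun w hw ↦ ?_⟩
    exact dist_le_of_mem_dyadicSquare hw hz

/-- Dyadic unions are bounded. [folklore] -/
theorem isBounded_dyadicUnion : IsBounded (dyadicUnion n F) :=
  (isBounded_biUnion F.finite_toSet).2 fun _ _ ↦ isBounded_dyadicSquare

end Union

namespace RestrictionConfig

/-- The origin lies in the closure of every configuration. [folklore] -/
theorem zero_mem_closure (K : RestrictionConfig) : (0 : ℂ) ∈ closure (K : Set ℂ) := by
  have : (0 : ℂ) ∈ closure (K : Set ℂ) ∩ range ((↑) : ℝ → ℂ) := by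
    rw [K.closure_inter_range_ofReal]
    rfl
  exact this.1

/-- The closure of a configuration lies in the closed upper half-plane. [folklore] -/
theorem closure_subset_setOf_im_nonneg (K : RestrictionConfig) :
    closure (K : Set ℂ) ⊆ {z : ℂ | 0 ≤ z.im} := by
  have h := closure_mono K.subset_upperHalfPlaneSet
  rwa [show closure upperHalfPlaneSet = {z : ℂ | 0 ≤ z.im} from Complex.closure_setOf_lt_im 0] at h

/-- **A compact disc off `cl K` is swallowed by a `*`-hull avoided by `K`, the fill of a finite
union of dyadic squares.** For `K ∈ Ω` and a closed disc `B̄(z, ε)` disjoint from `cl K`: join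
`z` to `−i` by a path in the open connected set `ℂ ∖ cl K` ([LSW] Def. 3.1 (2)); the dyadic
squares of a fine generation meeting the disc or the path form a compact set `S ⊇ B̄(z, ε)`
attached to the lower half-plane and still disjoint from `cl K ∋ 0`; its fill `hpFill S` is a
`*`-hull (`K ∪ (B(0, ρ) ∩ ℍ)` is connected, unbounded and misses `S`, so it lies in the
unbounded component of `ℍ ∖ S`, which therefore reaches `0`) avoided by `K`. [folklore] -/
theorem exists_dyadicUnion_isStarHull_hpFill (K : RestrictionConfig) {z : ℂ} {ε : ℝ} (hε : 0 ≤ ε)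
    (hdisj : Disjoint (closedBall z ε) (closure (K : Set ℂ))) :
    ∃ (n : ℕ) (F : Finset (ℤ × ℤ)), closedBall z ε ⊆ dyadicUnion n F ∧
      IsStarHull (hpFill (dyadicUnion n F)) ∧ Disjoint (K : Set ℂ) (hpFill (dyadicUnion n F)) := by
  -- the open connected set `U = ℂ ∖ cl K` contains `z` and `-i`
  set U : Set ℂ := (closure (K : Set ℂ))ᶜ with hU
  have hUo : IsOpen U := isClosed_closure.isOpen_compl
  have hUc : IsConnected U := K.2.2.2.2.2
  have hzU : z ∈ U := fun hz ↦ Set.disjoint_left.1 hdisj (mem_closedBall_self hε) hz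
  have hiU : -Complex.I ∈ U := fun h ↦ by
    have := K.closure_subset_setOf_im_nonneg h
    norm_num at this
  -- a path from `z` to `-i` inside `U`
  have hJ : JoinedIn U z (-Complex.I) := (hUo.isConnected_iff_isPathConnected.1 hUc).joinedIn z hzU _ hiU
  set π : Path z (-Complex.I) := hJ.somePath with hπ
  have hπU : ∀ t, π t ∈ U := hJ.somePath_mem
  -- the compact connected set `C = B̄(z, ε) ∪ range π ⊆ U`
  set C : Set ℂ := closedBall z ε ∪ range π with hC
  have hCc : IsCompact C := (isCompact_closedBall z ε).union (isCompact_range π.continuous)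
  have hCU : C ⊆ U := by
    rintro w (hw | ⟨t, rfl⟩)
    · exact fun hw' ↦ Set.disjoint_left.1 hdisj hw hw'
    · exact hπU t
  have hCconn : IsConnected C := by
    refine IsConnected.union ⟨z, mem_closedBall_self hε, ⟨0, π.source⟩⟩ ?_ (isConnected_range π.continuous)
    exact (convex_closedBall z ε).isConnected ⟨z, mem_closedBall_self hε⟩
  have hiC : -Complex.I ∈ C := Or.inr ⟨1, π.target⟩
  -- a fine generation `n`: squares meeting `C` stay inside `U`
  obtain ⟨δ, hδ, hδU⟩ := hCc.exists_cthickening_subset_open hUo hCU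
  obtain ⟨n, hn⟩ : ∃ n : ℕ, (2 : ℝ) / 2 ^ n ≤ δ := by
    obtain ⟨n, hn⟩ := exists_nat_gt (2 / δ)
    refine ⟨n, ?_⟩
    have h2n : (n : ℝ) < 2 ^ n := by exact_mod_cast Nat.lt_two_pow_self
    have h2 : (0 : ℝ) < 2 ^ n := by positivity
    rw [div_le_iff₀ h2]
    rw [div_lt_iff₀ hδ] at hn
    nlinarith
  -- the squares meeting `C`
  set F : Finset (ℤ × ℤ) := (finite_setOf_dyadicSquare_inter_nonempty hCc.isBounded n).toFinset with hF
  have hmemF : ∀ p : ℤ × ℤ, p ∈ F ↔ (dyadicSquare n p.1 p.2 ∩ C).Nonempty := fun p ↦ by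
    rw [hF, Set.Finite.mem_toFinset]
    rfl
  set S : Set ℂ := dyadicUnion n F with hS
  -- `C ⊆ S ⊆ U`
  have hCS : C ⊆ S := fun w hw ↦ by
    rw [hS, mem_dyadicUnion_iff]
    exact ⟨⟨_, _⟩, (hmemF _).2 ⟨w, mem_dyadicSquare_floor w n, hw⟩, mem_dyadicSquare_floor w n⟩
  have hSU : S ⊆ U := fun w hw ↦ by
    rw [hS, mem_dyadicUnion_iff] at hw
    obtain ⟨p, hp, hwp⟩ := hw
    obtain ⟨c, hcp, hcC⟩ := (hmemF p).1 hp
    exact hδU (mem_cthickening_of_dist_le w c δ C hcC ((dist_le_of_mem_dyadicSquare hwp hcp).trans hn))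
  have hKS : Disjoint (K : Set ℂ) S :=
    Set.disjoint_left.2 fun w hwK hwS ↦ hSU hwS (subset_closure hwK)
  have h0S : (0 : ℂ) ∉ S := fun h ↦ hSU h K.zero_mem_closure
  have hSclosed : IsClosed S := isClosed_dyadicUnion
  have hSb : IsBounded S := isBounded_dyadicUnion
  -- `S ∪ {Im ≤ 0}` is connected: every square meets the connected set `C ∪ {Im ≤ 0} ∋ -i`
  have hconn : IsConnected (S ∪ {w : ℂ | w.im ≤ 0}) := by
    have hD : IsPreconnected (C ∪ {w : ℂ | w.im ≤ 0}) :=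
      (hCconn.union ⟨-Complex.I, hiC, by simp⟩
        ((convex_halfSpace_im_le 0).isConnected ⟨0, by simp⟩)).isPreconnected
    have hDsub : C ∪ {w : ℂ | w.im ≤ 0} ⊆ S ∪ {w : ℂ | w.im ≤ 0} := union_subset_union_left _ hCS
    refine ⟨⟨-Complex.I, Or.inl (hCS hiC)⟩, isPreconnected_of_forall (-Complex.I) ?_⟩
    rintro y (hy | hy)
    · rw [hS, mem_dyadicUnion_iff] at hy
      obtain ⟨p, hp, hyp⟩ := hy
      obtain ⟨c, hcp, hcC⟩ := (hmemF p).1 hp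
      refine ⟨dyadicSquare n p.1 p.2 ∪ (C ∪ {w : ℂ | w.im ≤ 0}), ?_, Or.inr (Or.inl hiC),
        Or.inl hyp, ?_⟩
      · refine union_subset (fun w hw ↦ Or.inl ?_) hDsub
        rw [hS, mem_dyadicUnion_iff]
        exact ⟨p, hp, hw⟩
      · exact IsPreconnected.union c hcp (Or.inl hcC) convex_dyadicSquare.isPreconnected hD
    · exact ⟨C ∪ {w : ℂ | w.im ≤ 0}, hDsub, Or.inl hiC, Or.inr hy, hD⟩
  -- `K` lies in the unbounded component `V` of `ℍ ∖ S`, and so does `B(0, ρ) ∩ ℍ` for small `ρ`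
  set V : Set ℂ := Loewner.unboundedComponent (upperHalfPlaneSet \ S) with hV
  obtain ⟨ρ, hρ, hρS⟩ : ∃ ρ > 0, ball (0 : ℂ) ρ ⊆ Sᶜ :=
    Metric.isOpen_iff.1 hSclosed.isOpen_compl 0 h0S
  set W : Set ℂ := ball (0 : ℂ) ρ ∩ upperHalfPlaneSet with hW
  obtain ⟨k, hkK, hkρ⟩ : ((K : Set ℂ) ∩ ball 0 ρ).Nonempty := by
    have := K.zero_mem_closure
    rw [_root_.mem_closure_iff] at this
    obtain ⟨k, hk1, hk2⟩ := this (ball 0 ρ) isOpen_ball (mem_ball_self hρ)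
    exact ⟨k, hk2, hk1⟩
  have hTV : W ∪ (K : Set ℂ) ⊆ V := by
    refine subset_unboundedComponent_of_isPreconnected ?_ ?_ ?_
    · refine IsPreconnected.union k ⟨hkρ, K.subset_upperHalfPlaneSet hkK⟩ hkK ?_
        K.isConnected.isPreconnected
      exact ((convex_ball (0 : ℂ) ρ).inter (convex_halfSpace_im_gt 0)).isPreconnected
    · rintro w (⟨hwρ, hwH⟩ | hwK)
      · exact ⟨hwH, fun hwS ↦ hρS hwρ hwS⟩
      · exact ⟨K.subset_upperHalfPlaneSet hwK, Set.disjoint_left.1 hKS hwK⟩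
    · exact fun hb ↦ K.not_isBounded (hb.subset subset_union_right)
  -- hence `0 ∉ hpFill S = cl (ℍ ∖ V)`
  have h0 : (0 : ℂ) ∉ hpFill S := by
    intro h0
    change (0 : ℂ) ∈ closure (upperHalfPlaneSet \ V) at h0
    rw [_root_.mem_closure_iff] at h0
    obtain ⟨u, huρ, huH, huV⟩ := h0 (ball 0 ρ) isOpen_ball (mem_ball_self hρ)
    exact huV (hTV (Or.inl ⟨huρ, huH⟩))
  refine ⟨n, F, subset_union_left.trans hCS, isStarHull_hpFill isSimplyConnected_of_isConnected_compl_holds hSclosed hSb hconn h0, ?_⟩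
  -- and `K ⊆ V` misses `hpFill S`
  refine Set.disjoint_left.2 fun w hwK hwF ↦ ?_
  have : w ∈ hpFill S ∩ upperHalfPlaneSet := ⟨hwF, K.subset_upperHalfPlaneSet hwK⟩
  rw [hpFill_inter hSclosed hSb] at this
  exact this.2 (hTV (Or.inr hwK))

/-! ### Points are measurable for the avoidance σ-field -/

/-- The **detection events**: `K` avoids a `*`-hull which is the fill of a finite union of
dyadic squares containing the disc `B̄(z, ε)` (a countable union of generating events). [folklore] -/
def missNear (z : ℂ) (ε : ℝ) : Set RestrictionConfig :=
  ⋃ (n : ℕ) (F : Finset (ℤ × ℤ))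
    (_ : closedBall z ε ⊆ dyadicUnion n F ∧ IsStarHull (hpFill (dyadicUnion n F))),
    avoid (hpFill (dyadicUnion n F))

/-- The detection events are measurable. [folklore] -/
theorem measurableSet_missNear (z : ℂ) (ε : ℝ) : MeasurableSet (missNear z ε) :=
  MeasurableSet.iUnion fun _ ↦ MeasurableSet.iUnion fun _ ↦ MeasurableSet.iUnion fun h ↦
    measurableSet_avoid h.2

/-- A configuration in a detection event misses the disc. [folklore] -/
theorem disjoint_closedBall_of_mem_missNear {z : ℂ} {ε : ℝ} {K : RestrictionConfig}
    (h : K ∈ missNear z ε) : Disjoint (K : Set ℂ) (closedBall z ε) := by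
  simp only [missNear, mem_iUnion] at h
  obtain ⟨n, F, ⟨hsub, -⟩, hK⟩ := h
  refine Set.disjoint_left.2 fun w hwK hwB ↦ ?_
  exact Set.disjoint_left.1 (mem_avoid.1 hK) hwK
    (inter_subset_hpFill _ ⟨hsub hwB, K.subset_upperHalfPlaneSet hwK⟩)

/-- A configuration whose closure misses the disc lies in the detection event. [folklore] -/
theorem mem_missNear_of_disjoint {z : ℂ} {ε : ℝ} (hε : 0 ≤ ε) {K : RestrictionConfig}
    (h : Disjoint (closedBall z ε) (closure (K : Set ℂ))) : K ∈ missNear z ε := by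
  obtain ⟨n, F, hsub, hstar, hdisj⟩ := K.exists_dyadicUnion_isStarHull_hpFill hε h
  simp only [missNear, mem_iUnion]
  exact ⟨n, F, ⟨hsub, hstar⟩, mem_avoid.2 hdisj⟩

/-- **Points are measurable**: for every `z ∈ ℂ` the event `{K ∈ Ω : z ∈ K}` belongs to the
σ-field generated by the avoidance events `{K ∩ A = ∅}`, `A ∈ 𝒬*` ([LSW] §3 p. 10: "the
σ-field on `Ω` is the same as the Borel σ-field induced by the Hausdorff metric"; this is the
elementary half of that remark which is needed here). For `z ∈ ℍ`:
`{z ∈ K} = ⋂ₘ (missNear z (1/(m+1)))ᶜ`, because `K` is relatively closed in `ℍ` (Conway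
VIII.2.2, proved in the tree as `isSimplyConnected_of_isConnected_compl_holds`, enters through
`isStarHull_hpFill`). [cite: LawlerSchrammWerner2003Restriction, §3 p. 10 (the σ-field on Ω)] -/
theorem measurableSet_mem (z : ℂ) :
    MeasurableSet {K : RestrictionConfig | z ∈ (K : Set ℂ)} := by
  by_cases hz : 0 < z.im
  · have : {K : RestrictionConfig | z ∈ (K : Set ℂ)} = ⋂ m : ℕ, (missNear z (1 / ((m : ℝ) + 1)))ᶜ := by
      ext K
      simp only [mem_setOf_eq, mem_iInter, mem_compl_iff]
      constructor
      · intro hzK m hm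
        exact Set.disjoint_left.1 (disjoint_closedBall_of_mem_missNear hm) hzK
          (mem_closedBall_self (by positivity))
      · intro hm
        by_contra hzK
        -- `z ∉ cl K`, so a small closed disc around `z` misses `cl K`
        have hzcl : z ∉ closure (K : Set ℂ) := fun h ↦ by
          rcases K.closure_subset h with h' | h'
          · exact hzK h'
          · rw [mem_singleton_iff] at h'
            rw [h'] at hz
            simp at hz
        obtain ⟨η, hη, hball⟩ := Metric.isOpen_iff.1 isClosed_closure.isOpen_compl z hzcl
        obtain ⟨m, hm'⟩ := exists_nat_one_div_lt hη
        refine hm m (mem_missNear_of_disjoint (by positivity) ?_)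
        exact Set.disjoint_left.2 fun w hw hw' ↦
          hball (closedBall_subset_ball hm' hw) hw'
    rw [this]
    exact MeasurableSet.iInter fun m ↦ (measurableSet_missNear _ _).compl
  · have : {K : RestrictionConfig | z ∈ (K : Set ℂ)} = ∅ :=
      eq_empty_of_forall_notMem fun K hK ↦ hz (K.subset_upperHalfPlaneSet hK)
    rw [this]
    exact MeasurableSet.empty

/-- **Containing a disc is measurable**: `{K ∈ Ω : B(q, r) ⊆ K}` is measurable (`K` being
relatively closed in `ℍ`, it contains the disc iff it contains its points from a countable
dense set). [folklore] -/
theorem measurableSet_ball_subset (q : ℂ) (r : ℝ) :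
    MeasurableSet {K : RestrictionConfig | ball q r ⊆ (K : Set ℂ)} := by
  obtain ⟨D, hDc, hDd⟩ := TopologicalSpace.exists_countable_dense ℂ
  have : {K : RestrictionConfig | ball q r ⊆ (K : Set ℂ)} =
      ⋂ d ∈ D ∩ ball q r, {K : RestrictionConfig | d ∈ (K : Set ℂ)} := by
    ext K
    simp only [mem_setOf_eq, mem_iInter]
    constructor
    · intro h d hd
      exact h hd.2
    · intro h w hw
      have hcl : ball q r ⊆ closure (K : Set ℂ) :=
        (hDd.open_subset_closure_inter isOpen_ball).trans
          (closure_mono fun d hd ↦ h d ⟨hd.2, hd.1⟩)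
      have hH : ball q r ⊆ upperHalfPlaneSet := by
        have h1 : ball q r ⊆ {u : ℂ | 0 ≤ u.im} := hcl.trans K.closure_subset_setOf_im_nonneg
        have h2 := interior_maximal h1 isOpen_ball
        rwa [Complex.interior_setOf_le_im] at h2
      rw [← K.closure_inter_eq]
      exact ⟨hcl hw, hH hw⟩
  rw [this]
  exact MeasurableSet.biInter (hDc.mono inter_subset_left) fun d _ ↦ measurableSet_mem d

/-- **Having an interior point is measurable**: `{K ∈ Ω : int K ≠ ∅}` is measurable (a
countable union of the events `{B(d, 1/(m+1)) ⊆ K}`, `d` in a countable dense set). [folklore] -/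
theorem measurableSet_interior_nonempty :
    MeasurableSet {K : RestrictionConfig | (interior (K : Set ℂ)).Nonempty} := by
  obtain ⟨D, hDc, hDd⟩ := TopologicalSpace.exists_countable_dense ℂ
  have : {K : RestrictionConfig | (interior (K : Set ℂ)).Nonempty} =
      ⋃ d ∈ D, ⋃ m : ℕ, {K : RestrictionConfig | ball d (1 / ((m : ℝ) + 1)) ⊆ (K : Set ℂ)} := by
    ext K
    simp only [mem_setOf_eq, mem_iUnion]
    constructor
    · rintro ⟨w, hw⟩
      obtain ⟨r, hr, hball⟩ := Metric.isOpen_iff.1 isOpen_interior w hw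
      obtain ⟨m, hm⟩ := exists_nat_one_div_lt (half_pos hr)
      obtain ⟨d, hdD, hdw⟩ := hDd.exists_mem_open isOpen_ball ⟨w, mem_ball_self (half_pos hr)⟩
      refine ⟨d, hdD, m, fun u hu ↦ interior_subset (hball ?_)⟩
      rw [mem_ball] at hu hdw ⊢
      calc dist u w ≤ dist u d + dist d w := dist_triangle _ _ _
        _ < r / 2 + r / 2 := add_lt_add (hu.trans hm) hdw
        _ = r := by ring
    · rintro ⟨d, -, m, h⟩
      exact ⟨d, interior_maximal h isOpen_ball (mem_ball_self (by positivity))⟩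
  rw [this]
  exact MeasurableSet.biUnion hDc fun d _ ↦ MeasurableSet.iUnion fun m ↦
    measurableSet_ball_subset d _

/-- **Having empty interior is measurable.** [folklore] -/
theorem measurableSet_interior_eq_empty :
    MeasurableSet {K : RestrictionConfig | interior (K : Set ℂ) = ∅} := by
  have : {K : RestrictionConfig | interior (K : Set ℂ) = ∅} =
      {K : RestrictionConfig | (interior (K : Set ℂ)).Nonempty}ᶜ := by
    ext K
    simp [not_nonempty_iff_eq_empty]
  rw [this]
  exact measurableSet_interior_nonempty.compl

/-! ### Simple curves have empty interior -/

/-- A continuous injective path `γ : [0, ∞) → ℂ` with `‖γ(t)‖ → ∞` is a closed embedding (it is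
a proper map). [folklore] -/
theorem isClosedEmbedding_of_tendsto_norm_atTop {γ : ℝ≥0 → ℂ} (hc : Continuous γ)
    (hinj : Function.Injective γ) (h : Tendsto (fun t ↦ ‖γ t‖) atTop atTop) :
    IsClosedEmbedding γ := by
  refine IsClosedEmbedding.of_continuous_injective_isClosedMap hc hinj ?_
  refine (isProperMap_iff_tendsto_cocompact.2 ⟨hc, ?_⟩).isClosedMap
  rw [cocompact_eq_atTop, ← cobounded_eq_cocompact, ← comap_norm_atTop, tendsto_comap_iff]
  exact h

/-- **A simple curve has empty interior**: if `K = γ(0, ∞)` for a continuous injective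
`γ : [0, ∞) → ℂ` with `‖γ(t)‖ → ∞`, then `K` contains no disc. (A disc in `K` would contain a
circle `θ ↦ w + ρe^{iθ}`; pulled back through the embedding `γ` it would give a continuous
injective map of the circle into `[0, ∞) ⊆ ℝ`, which the intermediate value theorem forbids:
`f(θ) − f(θ + π)` changes sign on `[0, π]`.) [folklore] -/
theorem IsSimplePath.interior_eq_empty {K : RestrictionConfig} (hK : K.IsSimplePath) :
    interior (K : Set ℂ) = ∅ := by
  obtain ⟨γ, hc, hinj, -, htend, hKγ⟩ := hK
  have hemb := isClosedEmbedding_of_tendsto_norm_atTop hc hinj htend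
  by_contra hne
  obtain ⟨w, hw⟩ := nonempty_iff_ne_empty.2 hne
  obtain ⟨r, hr, hball⟩ := Metric.isOpen_iff.1 isOpen_interior w hw
  have hsub : ball w r ⊆ range γ := by
    refine (hball.trans interior_subset).trans ?_
    rw [hKγ]
    exact image_subset_range _ _
  -- the circle of radius `r/2` around `w`
  set c : ℝ → ℂ := fun θ ↦ w + (r / 2 : ℝ) * Complex.exp (θ * Complex.I) with hc_def
  have hcc : Continuous c := by
    rw [hc_def]
    fun_prop
  have hcmem : ∀ θ, c θ ∈ ball w r := fun θ ↦ by
    rw [mem_ball, dist_eq_norm, hc_def]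
    simp only [add_sub_cancel_left, norm_mul, Complex.norm_real, Real.norm_eq_abs,
      Complex.norm_exp_ofReal_mul_I, mul_one]
    rw [abs_of_pos (half_pos hr)]
    linarith
  have hcπ : ∀ θ, c (θ + Real.pi) = w - (r / 2 : ℝ) * Complex.exp (θ * Complex.I) := fun θ ↦ by
    rw [hc_def]
    simp only
    rw [Complex.ofReal_add, add_mul, Complex.exp_add_pi_mul_I]
    ring
  -- pull the circle back through `γ`
  choose f hf using fun θ ↦ hsub (hcmem θ)
  have hfc : Continuous f := by
    rw [hemb.isInducing.continuous_iff]
    have : γ ∘ f = c := funext hf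
    rw [this]
    exact hcc
  -- `g(θ) = f(θ) - f(θ + π)` satisfies `g(π) = -g(0)`
  set g : ℝ → ℝ := fun θ ↦ (f θ : ℝ) - f (θ + Real.pi) with hg
  have hgc : Continuous g := by
    rw [hg]
    fun_prop
  have h2π : f (Real.pi + Real.pi) = f 0 := by
    apply hinj
    rw [hf, hf, hcπ, hc_def]
    simp only
    rw [Complex.ofReal_zero, zero_mul, Complex.exp_zero, Complex.exp_pi_mul_I]
    ring
  have hgπ : g Real.pi = -g 0 := by
    simp only [hg, h2π, zero_add]
    ring
  -- so `g` vanishes somewhere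
  obtain ⟨θ₀, hθ₀⟩ : ∃ θ₀, g θ₀ = 0 := by
    rcases le_total (g 0) 0 with h0 | h0
    · exact intermediate_value_univ 0 Real.pi hgc ⟨h0, by linarith⟩
    · exact intermediate_value_univ Real.pi 0 hgc ⟨by linarith, h0⟩
  have heq : f θ₀ = f (θ₀ + Real.pi) := NNReal.coe_injective (sub_eq_zero.1 hθ₀)
  have hcirc : c θ₀ = c (θ₀ + Real.pi) := by rw [← hf, ← hf, heq]
  rw [hcπ, hc_def] at hcirc
  simp only at hcirc
  have : (r / 2 : ℝ) * Complex.exp (θ₀ * Complex.I) = 0 := by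
    have h2 : (2 : ℂ) * ((r / 2 : ℝ) * Complex.exp (θ₀ * Complex.I)) = 0 := by
      linear_combination hcirc
    simpa using h2
  rcases mul_eq_zero.1 this with h | h
  · have : (r / 2 : ℝ) = 0 := by exact_mod_cast h
    linarith
  · exact Complex.exp_ne_zero _ h

/-! ### The glue with "supported on simple curves" -/

/-- **If almost every configuration has an interior point, the simple curves do not have full
outer measure**: the measurable event `{K : int K = ∅}` contains every simple-curve
configuration and is `P`-null, so some measurable event containing the simple curves has
`P`-probability `< 1` — the negation of the hypothesis of
`IsRestrictionMeasure.eq_five_eighths_of_outer_simple`. This is how the bubble description of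
`P_α`, `α > 5/8` ([LSW] Thm. 7.3: a Poisson cloud of filled Brownian bubbles of positive
intensity) yields "`P_α` is not supported on simple curves" (p. 5 result 2). [folklore] -/
theorem exists_measurableSet_simple_subset_of_ae_interior_nonempty (P : Measure RestrictionConfig)
    (hae : ∀ᵐ K : RestrictionConfig ∂P, (interior (K : Set ℂ)).Nonempty) :
    ∃ S : Set RestrictionConfig, MeasurableSet S ∧ {K | K.IsSimplePath} ⊆ S ∧ P S < 1 := by
  refine ⟨{K | interior (K : Set ℂ) = ∅}, measurableSet_interior_eq_empty,
    fun K hK ↦ IsSimplePath.interior_eq_empty hK, ?_⟩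
  have h0 : P {K : RestrictionConfig | interior (K : Set ℂ) = ∅} = 0 := by
    rw [ae_iff] at hae
    convert hae using 2
    ext K
    simp [not_nonempty_iff_eq_empty]
  rw [h0]
  exact zero_lt_one

end RestrictionConfig

end Literature.Probability.RandomPlanarGeometry

end
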